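import Literature.MathematicalPhysics.QuantumFieldTheory.Balaban1983to89.B9Eq3147MiddleWordSupRowClosed
import Literature.MathematicalPhysics.QuantumFieldTheory.Balaban1983to89.B9Eq3147MiddleWordSliceGradRowClosed
import Literature.MathematicalPhysics.QuantumFieldTheory.Balaban1983to89.B9Eq347GlobalFromLocal

/-!
# `Balaban1983to89.B9Eq347MiddleWordSupGradGlobal` — T. Bałaban, *Propagators for lattice gauge theories in a background field*, Commun. Math. Phys. **99** (1985)
# 389–434 [Balaban1985BackgroundPropagators] Thm 3.1 (3.47) p. 398 with p. 398 l. 19–20 *«the global inequalities (3.47) are consequences of the local ones (3.42)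
# and Lemma 2.1»*, Thm 3.3 p. 399, (3.147) p. 425, (3.153) p. 426, Thm 3.13 p. 426, and [Balaban1985Variational] (111) p. 294, (117) p. 295: **THE GLOBAL SUP → SUP
# BOUNDS OF THE MIDDLE WORD `H₁,kQ_kG₁,k` OF `𝔊̃_k = 𝔓_kG₁,k` AND OF ITS COVARIANT GRADIENT, WITH ONE HEIGHT-FREE CONSTANT — `∃ α₁ B` BEFORE `∀ n η c₀ c₁ m U`** —
# the NE9 owner's (E3) `B9Eq347G1kSupGradGlobal.exists_global_supGrad_G1k` (t4-ne9-p1 g96) BYTE FOR BYTE with this lineage's (K66)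
# `B9Eq3147MiddleWordSupRowClosed.exists_local_letter_H1kQkG1k` and (K68) `B9Eq3147MiddleWordSliceGradRowClosed.exists_local_gradLetter_H1kQkG1k` in place of (K64) ∕ (E2),
# summed over the source blocks by ne9-leaf-03's (G) `B9Eq347GlobalFromLocal.norm_apply_le_of_local` with the VOLUME-FREE row constant of `B4Sect5Torus.torusSum_le`
# (plan v12 `t4/b2b-balaban-t4-ne9-p1/g96/PLAN-V12-117-SOCKET.md` (P3): «`B` height-free from (E3)-type bounds of the words»)

statement-level skeleton of published theorems with citation tags; proofs where landed; nothing here is a claim about the Yang–Mills mass gap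

CITATION HEADER (lean-in-tree rule).  Audit cell `pub-balaban`, sub-cell `t4`, BINDER row NE9; filed by NE9 crux-team LEAF PROVER 05
(`b2b-balaban-t4-ne9-formalise-leaf-05`, gen 87); the proof text is the owner's (E3) with the two suppliers and the propagator word substituted — CREDITED.
Imports (K66), (K68) (through them (K64), (K65), (K67), the owner's (E2)) and (G).  Sources READ first-hand this generation (`paper:balaban1985-cmp99-background-propagators`,
journal page = PDF page + 388): p. 397 (3.42), p. 398 (3.47) and l. 17–20, p. 399 Thm 3.3, p. 425 (3.147), p. 426 (3.153); [Balaban1984PropagatorsII] Lemma 2.1 through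
(G)'s audited header.  Print's multi-level weights (3.41) are NOT reproduced (one level on top); [folklore] summation BY NAME.

WHAT IS PROVED (sorry-free; proof lane — 0 `def`; [folklore]).  **`exists_global_supGrad_H1kQkG1k`** — `∃ α₁ B, 0 < α₁ ∧ 0 ≤ B ∧ ∀ ⟨(K65)'s binder block VERBATIM
up to `hpos`⟩ (f : BondL2K) (M) (0 ≤ M) (‖f(b)‖ ≤ M) (μ) (b), ‖(H₁,kQ_kG₁,kf)(b)‖ ≤ B·M ∧ ‖(D_U(H₁,kQ_kG₁,kf)_μ)(b)‖ ≤ B·M ∧ ‖(∇_U(H₁,kQ_kG₁,kf))(b, μ)‖ ≤ B·M`: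
(K66) gives `(α_V, B_V, δ_V)`, (K68) gives `(α_D, B_D, δ_D)`; `α₁ := min α_V α_D`, `B := B_V·K_d(δ_V) + B_D·K_d(δ_D)`; each local letter read on the plain bond
functions and summed by (G) `norm_apply_le_of_local` (`π := Π∘bpos`, output `π′ := Π∘bpos` for both members) with `torusSum_le`; the `covGrad` member by (VGT-a)
`norm_covGrad_apply_le_of_slice`.
HONEST SCOPE.  Summation BY NAME; `B` symbolic and crude; ONE weight (the top level); the MODEL letters, `hRlev`, `hpos′`∕`hpos` DISPLAYED; the (117) bound proper
(all three words of `𝔓_k`, the jet reading `B11Eq115KernelOp.mkJetCLM`) is NOT here; nothing of [B9] Thm 3.1∕3.3∕3.11∕3.13 is asserted, valued or discharged.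
NOT NE9 (cell pub-balaban: NE9 NOT PRINTED ∕ NOT PROVED; «NE9 ⇐ the named binders»; row WALLED ON A MODEL (O-NE9-1; #5 UNRULED); spine PROVED 0∕9; rung (B)+1
on a finite T⁴ — NOT infinite volume, NOT mass gap, NOT BetaPertH, NOT Clay; HONEST DEPENDENCY: continuum YM on T⁴ ⇐ BetaPertH ∧ nine spine estimates (0/9
proved); BetaPertH ⇐ (D1) ∧ (D4) ∧ CAP+tail; G-an2-4 gates asym, D1 and NE2/3/4).  NEW file; nothing modified.  Net new unproved facts: 0.
-/

noncomputable section

set_option autoImplicit false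

open scoped InnerProductSpace ComplexConjugate BigOperators

namespace Literature.MathematicalPhysics.QuantumFieldTheory.Balaban1983to89.B9Eq347MiddleWordSupGradGlobal

open B4Sect5Torus (TSite tdist torusSum_le)
open B4Sect5Proof (latticeConst latticeConst_nonneg)
open B9SectCLatticeCarrier (Bond bpos btgt unshift)
open B9Eq311L2Pairing (WL2)
open B9Eq33CovDerivVector (covGrad)
open B9Eq319QprimeTorus (fineP blockCoord)
open B7Prop1Explicit (U1 Wcx boxVec)
open B11Eq103H1Complex (SiteL2K BondL2K covDerivL2K)
open B9Eq310DeltaPrime (plaqHolU)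
open B9Eq310HessianOperator (adTransportW)
open B9Eq315QTorus (perCfg cornerSite)
open B9Eq315QTower (towerP UlevOf)
open B9Eq316TowerFlatIsOneStep (towerP_eq_fineP_pow siteCast)
open B9Eq326OperatorTower (QkW laplaceAk G1k H1k)
open B9Eq324DeltaPrimeATower (laplacePrimeAk)
open B9Eq3147MiddleWordSupRowClosed (exists_local_letter_H1kQkG1k)
open B9Eq3147MiddleWordSliceGradRowClosed (exists_local_gradLetter_H1kQkG1k)
open B9Eq347GlobalFromLocal (norm_apply_le_of_local)
open B9Eq326LocalPartTowerSliceGradientRow (norm_covGrad_apply_le_of_slice)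

variable {d : ℕ} (hd : 1 ≤ d) (L : ℕ) [NeZero L] (hL : 1 ≤ L) (hL3 : 3 ≤ L)
  {𝔸 : Type*} [NormedRing 𝔸] [NormedAlgebra ℂ 𝔸] [CompleteSpace 𝔸] [NormOneClass 𝔸] [StarRing 𝔸] [NormedStarGroup 𝔸] [StarModule ℂ 𝔸]
  {W : Type*} [NormedAddCommGroup W] [InnerProductSpace ℂ W] [FiniteDimensional ℂ W] (φ : W ≃ₗ[ℂ] 𝔸)
  {Mφ Mφ' : ℝ} (hMφ : 0 ≤ Mφ) (hMφ' : 0 ≤ Mφ') (hφ : ∀ w, ‖φ w‖ ≤ Mφ * ‖w‖) (hφ' : ∀ X, ‖φ.symm X‖ ≤ Mφ' * ‖X‖) (hstar : ∀ X : 𝔸, ‖star X‖ ≤ ‖X‖)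
  {a : ℝ} (ha : 0 < a) {a' : ℝ} (ha' : 0 < a') {ϱ : ℝ} (hϱ0 : 0 ≤ ϱ) (hϱ1 : ϱ < 1)
  (τ : 𝔸 →ₗ[ℂ] ℂ) {Cτ : ℝ} (hτ : ∀ X, ‖τ X‖ ≤ Cτ * ‖X‖) (hCτ : 0 ≤ Cτ) {Mτ : ℝ} (hτm : ∀ X Y : 𝔸, ‖τ (X * Y)‖ ≤ Mτ * ‖X‖ * ‖Y‖) (hMτ : 0 ≤ Mτ)
  {ρw : ℝ} (hρw : 0 ≤ ρw)
  (hτ₁ : ∀ X : 𝔸, τ (star X) = conj (τ X)) (hτ₂ : ∀ X Y : 𝔸, τ (X * Y) = τ (Y * X)) (hφτ : ∀ X Y : 𝔸, ⟪φ.symm X, φ.symm Y⟫_ℂ = τ (star X * Y))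
  (AQ : ℝ)

set_option maxHeartbeats 400000 in -- as the owner's (E3): (K64)'s ≈ 45 binders twice (value + gradient suppliers); the final defeq assembly exceeds the default budget
include hd hL hL3 hMφ hMφ' hφ hφ' hstar ha ha' hϱ0 hϱ1 hτ hCτ hτm hMτ hρw hτ₁ hτ₂ hφτ in
/-- **THE GLOBAL SUP → SUP BOUNDS OF THE MIDDLE WORD `H₁,kQ_kG₁,k` AND OF ITS COVARIANT GRADIENT, ONE HEIGHT-FREE CONSTANT** ((3.47) from (3.42) *«and
Lemma 2.1»* at the tower's top level, for the middle word of `𝔊̃_k = 𝔓_kG₁,k`; the owner's (E3) `exists_global_supGrad_G1k` BYTE FOR BYTE with (K66) ∕ (K68) in place of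
(K64) ∕ (E2)).  For every height, spacing on the diagonal, period, background of the MODEL letters in one window `α ≤ α₁`, ANY positivity witnesses, EVERY bond
field `f` with `‖f‖_∞ ≤ M`, every component `μ` and bond `b`: `‖(H₁,kQ_kG₁,kf)(b)‖ ≤ B·M`, `‖(D_U(H₁,kQ_kG₁,kf)_μ)(b)‖ ≤ B·M`, `‖(∇_U(H₁,kQ_kG₁,kf))(b, μ)‖ ≤ B·M`.
[cite: Balaban1985BackgroundPropagators, Thm 3.1 (3.47) p.398, (3.42) p.397, Thm 3.3 p.399, (3.147) p.425, (3.153) p.426, Thm 3.13 p.426; Balaban1985Variational,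
(111) p.294, (115) p.294, (117) p.295] [cite: Balaban1984PropagatorsII, Lemma 2.1 (2.61) p.234] -/
theorem exists_global_supGrad_H1kQkG1k :
    ∃ α₁ B : ℝ, 0 < α₁ ∧ 0 ≤ B ∧
      ∀ (n : ℕ) (η : ℝ) (_hηL : η * (L : ℝ) ^ (n + 1) = 1) (c₀ c₁ : ℝ) [Fact (0 < c₀)] [Fact (0 < c₁)]
        (_hw : c₀ * ((L : ℝ) ^ (n + 1)) ^ d = c₁) (_hρ : |η| ^ d / c₀ ≤ ρw) (m : Fin d → ℕ) [∀ i, NeZero (m i)] (_hm : ∀ i, 1 ≤ m i)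
        (U : Bond d (towerP L m (n + 1)) → 𝔸ˣ) (αU : ℕ → ℝ) (_hα0 : ∀ j, 0 ≤ αU j) (hα1 : ∀ j, αU j ≤ 1 / 64)
        (hαL : ∀ j, 50 * (d + 1) * αU j * (L : ℝ) ^ d ≤ 1 / 2)
        (hU1 : ∀ (j : ℕ) (x : B7Prop1Explicit.Site d) (k : Fin d), perCfg (towerP L m (j + 1)) (UlevOf L m (n + 1) U j) x k ∈ U1 𝔸)
        (hreg : ∀ (j : ℕ) (y : TSite d (towerP L m j)) (k : Fin d) (ρ' : Fin d → Fin L),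
          ‖((Wcx L (perCfg (towerP L m (j + 1)) (UlevOf L m (n + 1) U j)) (cornerSite L y) k (boxVec L ρ') : 𝔸ˣ) : 𝔸) - 1‖ ≤ αU j)
        (εU : ℕ → ℝ) (_hεU : ∀ j, 0 ≤ εU j) (_hUε : ∀ (j : ℕ) (b : Bond d (towerP L m (j + 1))), ‖(UlevOf L m (n + 1) U j b : 𝔸) - 1‖ ≤ εU j)
        (_hLb : ∀ (j : ℕ) (b : Bond d (towerP L m (j + 1))), UlevOf L m (n + 1) U j b ∈ U1 𝔸)
        (α : ℝ) (_hα : 0 ≤ α) (_hαle : α ≤ α₁)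
        (hUst : ∀ b, star (U b : 𝔸) = (((U b)⁻¹ : 𝔸ˣ) : 𝔸)) (_hUb : ∀ b, U b ∈ U1 𝔸) (_hUη : ∀ b, ‖(U b : 𝔸) - 1‖ ≤ α * η)
        (_hpl : ∀ p : B9SectCLatticeCarrier.Plaq d (towerP L m (n + 1)), ‖(plaqHolU U p : 𝔸) - 1‖ ≤ α * η ^ 2)
        (_hUgrad : ∀ (x : TSite d (towerP L m (n + 1))) (μ : Fin d), ‖(U (x, μ) : 𝔸) - U (unshift μ x, μ)‖ ≤ α * η ^ 2)
        (_hRlev : ∀ (j : ℕ) (b : Bond d (towerP L m (j + 1))) (w : W), ‖adTransportW φ (UlevOf L m (n + 1) U j) b w‖ ≤ ‖w‖)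
        (_hεg : ∀ j < n + 1, εU j ≤ α * ϱ ^ j) (_hAQ : ∑ j ∈ Finset.range (n + 1), αU j ≤ AQ)
        (hpos' : ∀ x : SiteL2K ℂ d (towerP L m (n + 1)) c₀ W, x ≠ 0 → 0 < RCLike.re ⟪x, laplacePrimeAk L m n φ η U a' (c₁ := c₁) x⟫_ℂ)
        (hpos : ∀ x : BondL2K ℂ d (towerP L m (n + 1)) c₀ W, x ≠ 0 →
          0 < RCLike.re ⟪x, laplaceAk L m n φ η U hL αU hα1 hU1 hreg τ (c₀ := c₀) (c₁ := c₁) a x⟫_ℂ)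
        (f : BondL2K ℂ d (towerP L m (n + 1)) c₀ W) (M : ℝ) (_hM : 0 ≤ M) (_hfM : ∀ b, ‖WL2.equiv ℂ (fun _ : Bond d (towerP L m (n + 1)) => c₀) W f b‖ ≤ M) (μ : Fin d) (b : Bond d (towerP L m (n + 1))),
        ‖WL2.equiv ℂ (fun _ : Bond d (towerP L m (n + 1)) => c₀) W (H1k L m n φ η U hL αU hα1 hU1 hreg τ (c₀ := c₀) (c₁ := c₁) hαL hpos (QkW L m n φ U hL αU hα1 hU1 hreg (c₀ := c₀) (c₁ := c₁) (G1k L m n φ η U hL αU hα1 hU1 hreg τ (c₀ := c₀) (c₁ := c₁) hpos f))) b‖ ≤ B * M ∧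
          ‖WL2.equiv ℂ (fun _ : Bond d (towerP L m (n + 1)) => c₀) W (covDerivL2K ℂ c₀ ((η : ℂ))⁻¹ (adTransportW φ U) ((WL2.equiv ℂ (fun _ : TSite d (towerP L m (n + 1)) => c₀) W).symm fun y => WL2.equiv ℂ (fun _ : Bond d (towerP L m (n + 1)) => c₀) W (H1k L m n φ η U hL αU hα1 hU1 hreg τ (c₀ := c₀) (c₁ := c₁) hαL hpos (QkW L m n φ U hL αU hα1 hU1 hreg (c₀ := c₀) (c₁ := c₁) (G1k L m n φ η U hL αU hα1 hU1 hreg τ (c₀ := c₀) (c₁ := c₁) hpos f))) (y, μ))) b‖ ≤ B * M ∧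
          ‖covGrad ((η : ℂ))⁻¹ (adTransportW φ U) (WL2.equiv ℂ (fun _ : Bond d (towerP L m (n + 1)) => c₀) W (H1k L m n φ η U hL αU hα1 hU1 hreg τ (c₀ := c₀) (c₁ := c₁) hαL hpos (QkW L m n φ U hL αU hα1 hU1 hreg (c₀ := c₀) (c₁ := c₁) (G1k L m n φ η U hL αU hα1 hU1 hreg τ (c₀ := c₀) (c₁ := c₁) hpos f)))) (b, μ)‖ ≤ B * M := by
  classical
  obtain ⟨αV, BV, δV, hαV, hBV, hδV, HV⟩ := exists_local_letter_H1kQkG1k hd L hL hL3 φ hMφ hMφ' hφ hφ' hstar ha ha' hϱ0 hϱ1 τ hτ hCτ hτm hMτ hρw hτ₁ hτ₂ hφτ AQ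
  obtain ⟨αD, BD, δD, hαD, hBD, hδD, HD⟩ := exists_local_gradLetter_H1kQkG1k hd L hL hL3 φ hMφ hMφ' hφ hφ' hstar ha ha' hϱ0 hϱ1 τ hτ hCτ hτm hMτ hρw hτ₁ hτ₂ hφτ AQ
  have hKV : 0 ≤ latticeConst d δV := latticeConst_nonneg d hδV.le
  have hKD : 0 ≤ latticeConst d δD := latticeConst_nonneg d hδD.le
  refine ⟨min αV αD, BV * latticeConst d δV + BD * latticeConst d δD, lt_min hαV hαD, by positivity, ?_⟩
  intro n η hηL c₀ c₁ _ _ hw hρ m _ hm U αU hα0 hα1 hαL hU1 hreg εU hεU hUε hLb α hα hαle hUst hUb hUη hpl hUgrad hRlev hεg hAQ hpos' hpos f M hM0 hfM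
    μ b
  have hαV' : α ≤ αV := hαle.trans (min_le_left _ _)
  have hαD' : α ≤ αD := hαle.trans (min_le_right _ _)
  -- the two propagator maps read on the plain bond functions
  obtain ⟨TV, hTV⟩ : ∃ T : (Bond d (towerP L m (n + 1)) → W) →ₗ[ℂ] (Bond d (towerP L m (n + 1)) → W),
      ∀ g x, T g x = WL2.equiv ℂ (fun _ : Bond d (towerP L m (n + 1)) => c₀) W (H1k L m n φ η U hL αU hα1 hU1 hreg τ (c₀ := c₀) (c₁ := c₁) hαL hpos (QkW L m n φ U hL αU hα1 hU1 hreg (c₀ := c₀) (c₁ := c₁) (G1k L m n φ η U hL αU hα1 hU1 hreg τ (c₀ := c₀) (c₁ := c₁) hpos (((WL2.equiv ℂ (fun _ : Bond d (towerP L m (n + 1)) => c₀) W)).symm g)))) x :=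
    ⟨(WL2.linearEquiv ℂ ℂ (fun _ : Bond d (towerP L m (n + 1)) => c₀)).toLinearMap ∘ₗ ((H1k L m n φ η U hL αU hα1 hU1 hreg τ (c₀ := c₀) (c₁ := c₁) hαL hpos) ∘ₗ (QkW L m n φ U hL αU hα1 hU1 hreg (c₀ := c₀) (c₁ := c₁)) ∘ₗ (G1k L m n φ η U hL αU hα1 hU1 hreg τ (c₀ := c₀) (c₁ := c₁) hpos)) ∘ₗ
      (WL2.linearEquiv ℂ ℂ (fun _ : Bond d (towerP L m (n + 1)) => c₀)).symm.toLinearMap, fun _ _ => rfl⟩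
  obtain ⟨TD, hTD⟩ : ∃ T : (Bond d (towerP L m (n + 1)) → W) →ₗ[ℂ] (Bond d (towerP L m (n + 1)) → W),
      ∀ g x, T g x = WL2.equiv ℂ (fun _ : Bond d (towerP L m (n + 1)) => c₀) W (covDerivL2K ℂ c₀ ((η : ℂ))⁻¹ (adTransportW φ U)
        ((WL2.equiv ℂ (fun _ : TSite d (towerP L m (n + 1)) => c₀) W).symm fun y => WL2.equiv ℂ (fun _ : Bond d (towerP L m (n + 1)) => c₀) W (H1k L m n φ η U hL αU hα1 hU1 hreg τ (c₀ := c₀) (c₁ := c₁) hαL hpos (QkW L m n φ U hL αU hα1 hU1 hreg (c₀ := c₀) (c₁ := c₁) (G1k L m n φ η U hL αU hα1 hU1 hreg τ (c₀ := c₀) (c₁ := c₁) hpos (((WL2.equiv ℂ (fun _ : Bond d (towerP L m (n + 1)) => c₀) W)).symm g)))) (y, μ))) x :=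
    ⟨(WL2.linearEquiv ℂ ℂ (fun _ : Bond d (towerP L m (n + 1)) => c₀)).toLinearMap ∘ₗ
      (covDerivL2K ℂ c₀ ((η : ℂ))⁻¹ (adTransportW φ U) ∘ₗ
        (WL2.linearEquiv ℂ ℂ (fun _ : TSite d (towerP L m (n + 1)) => c₀)).symm.toLinearMap ∘ₗ
        LinearMap.funLeft ℂ W (fun y : TSite d (towerP L m (n + 1)) => ((y, μ) : Bond d (towerP L m (n + 1)))) ∘ₗ
        (WL2.linearEquiv ℂ ℂ (fun _ : Bond d (towerP L m (n + 1)) => c₀)).toLinearMap) ∘ₗ ((H1k L m n φ η U hL αU hα1 hU1 hreg τ (c₀ := c₀) (c₁ := c₁) hαL hpos) ∘ₗ (QkW L m n φ U hL αU hα1 hU1 hreg (c₀ := c₀) (c₁ := c₁)) ∘ₗ (G1k L m n φ η U hL αU hα1 hU1 hreg τ (c₀ := c₀) (c₁ := c₁) hpos)) ∘ₗ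
      (WL2.linearEquiv ℂ ℂ (fun _ : Bond d (towerP L m (n + 1)) => c₀)).symm.toLinearMap, fun _ _ => rfl⟩
  -- their local letters
  have hlocV : ∀ (v : TSite d m) (g : Bond d (towerP L m (n + 1)) → W) (F : ℝ), (∀ y, blockCoord (L ^ (n + 1)) m (siteCast (towerP_eq_fineP_pow L m (n + 1)) (bpos y)) ≠ v → g y = 0) → (∀ y, ‖g y‖ ≤ F) →
      ∀ x, ‖TV g x‖ ≤ BV * Real.exp (-(δV * tdist m (blockCoord (L ^ (n + 1)) m (siteCast (towerP_eq_fineP_pow L m (n + 1)) (bpos x))) v)) * F := by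
    intro v g F hgv hgF x
    rw [hTV]
    exact HV n η hηL c₀ c₁ hw hρ m hm U αU hα0 hα1 hαL hU1 hreg εU hεU hUε hLb α hα hαV' hUst hUb hUη hpl hUgrad hRlev hεg hAQ hpos' hpos v
      (((WL2.equiv ℂ (fun _ : Bond d (towerP L m (n + 1)) => c₀) W)).symm g) F (fun y hy => by rw [Equiv.apply_symm_apply]; exact hgv y hy) (fun y => by rw [Equiv.apply_symm_apply]; exact hgF y) x
  have hlocD : ∀ (v : TSite d m) (g : Bond d (towerP L m (n + 1)) → W) (F : ℝ), (∀ y, blockCoord (L ^ (n + 1)) m (siteCast (towerP_eq_fineP_pow L m (n + 1)) (bpos y)) ≠ v → g y = 0) → (∀ y, ‖g y‖ ≤ F) →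
      ∀ x, ‖TD g x‖ ≤ BD * Real.exp (-(δD * tdist m (blockCoord (L ^ (n + 1)) m (siteCast (towerP_eq_fineP_pow L m (n + 1)) (bpos x))) v)) * F := by
    intro v g F hgv hgF x
    rw [hTD]
    exact (HD n η hηL c₀ c₁ hw hρ m hm U αU hα0 hα1 hαL hU1 hreg εU hεU hUε hLb α hα hαD' hUst hUb hUη hpl hUgrad hRlev hεg hAQ hpos' hpos v
      (((WL2.equiv ℂ (fun _ : Bond d (towerP L m (n + 1)) => c₀) W)).symm g) F (fun y hy => by rw [Equiv.apply_symm_apply]; exact hgv y hy) (fun y => by rw [Equiv.apply_symm_apply]; exact hgF y) μ x).1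
  -- one summation over the source blocks each (volume-free row constants)
  have hV := norm_apply_le_of_local (fun y : Bond d (towerP L m (n + 1)) => blockCoord (L ^ (n + 1)) m (siteCast (towerP_eq_fineP_pow L m (n + 1)) (bpos y))) (fun x : Bond d (towerP L m (n + 1)) => blockCoord (L ^ (n + 1)) m (siteCast (towerP_eq_fineP_pow L m (n + 1)) (bpos x)))
    (tdist m) TV hBV hlocV (fun u => torusSum_le d hm hδV u) (WL2.equiv ℂ (fun _ : Bond d (towerP L m (n + 1)) => c₀) W f) hM0 hfM b
  have hD := norm_apply_le_of_local (fun y : Bond d (towerP L m (n + 1)) => blockCoord (L ^ (n + 1)) m (siteCast (towerP_eq_fineP_pow L m (n + 1)) (bpos y))) (fun x : Bond d (towerP L m (n + 1)) => blockCoord (L ^ (n + 1)) m (siteCast (towerP_eq_fineP_pow L m (n + 1)) (bpos x)))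
    (tdist m) TD hBD hlocD (fun u => torusSum_le d hm hδD u) (WL2.equiv ℂ (fun _ : Bond d (towerP L m (n + 1)) => c₀) W f) hM0 hfM b
  rw [hTV, Equiv.symm_apply_apply] at hV
  rw [hTD, Equiv.symm_apply_apply] at hD
  have h1 : BV * latticeConst d δV * M ≤ (BV * latticeConst d δV + BD * latticeConst d δD) * M :=
    mul_le_mul_of_nonneg_right (le_add_of_nonneg_right (mul_nonneg hBD hKD)) hM0
  have h2 : BD * latticeConst d δD * M ≤ (BV * latticeConst d δV + BD * latticeConst d δD) * M :=
    mul_le_mul_of_nonneg_right (le_add_of_nonneg_left (mul_nonneg hBV hKV)) hM0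
  exact ⟨hV.trans h1, hD.trans h2, norm_covGrad_apply_le_of_slice _ _ _ b μ (hD.trans h2)⟩

end Literature.MathematicalPhysics.QuantumFieldTheory.Balaban1983to89.B9Eq347MiddleWordSupGradGlobal

end
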